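import Mathlib
import Summits.KontsevichZagierPeriods.KontsevichZagierPeriods.Theorems.SymplecticScissorsPlanarSAZylevEquidec

/-!
# Crux `SymplecticScissors.PlanarSAZylev` (stmt-KontsevichZagierPeriods-9848), line `reservoir-peeling`:
the type monoid of bounded `ℚ`-regions modulo the pinned pseudogroup equivalence

The pinned relation `E A B` of the line ("an open co-null `ℚ`-semialgebraic part `U` of `A` is
carried by ONE `ℚ`-semialgebraic `C¹` injection with `|det| = 1` onto a co-null part of `B`") is
quantified together with its defining hypothesis `HE`, as in every stub of the line.

`assembly_exists_monoid`: granted symmetry, transitivity and gluing of `E` (stubs `stub_teSymm`,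
`stub_teCalc`, `stub_teGlue`, all landed), there is an additive commutative monoid `M` presented as
"bounded `ℚ`-semialgebraic planar sets modulo `E`" by a map `mk` with
`mk A = mk B ↔ E A B`, `mk A + mk B = mk (A ∪ B)` for disjoint `A`, `B`, `mk ∅ = 0`, `mk` onto —
exactly the presentation consumed by the landed stubs `stub_planarCancel` (cancellativity) and
`stub_decode` (`K₀` decoding).  Construction: the quotient of the subtype of bounded
`ℚ`-semialgebraic sets by `E`, with `[A] + [B] := [A ∪ B']` for a rational translate `B'` of `B`
disjoint from `A` (`assembly_exists_shift`, `mosaic_translate`); well-definedness, commutativity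
and associativity are instances of gluing.

No definitions (the monoid is produced inside the proof and exported existentially). [folklore]
-/

noncomputable section

open MeasureTheory Set
open Literature.NumberTheory.Transcendental Literature.ModelTheory.ExponentialFields

namespace Summit.KontsevichZagierPeriods.SymplecticScissors.PlanarSAZylev

/-- A translate of a bounded planar set is bounded. [folklore] -/
theorem monoid_isBounded_translate {B : Set (Fin 2 → ℝ)} (hB : Bornology.IsBounded B)
    (v : Fin 2 → ℝ) : Bornology.IsBounded ((fun x => x + v) '' B) := by
  rw [← Set.add_singleton]
  exact hB.add Bornology.isBounded_singleton

/-- **Placement**: next to any bounded `ℚ`-region `A`, every bounded `ℚ`-region `B` has a disjoint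
`E`-copy (a rational translate, `assembly_exists_shift` and `mosaic_translate`). [folklore] -/
theorem monoid_exists_place (E : Set (Fin 2 → ℝ) → Set (Fin 2 → ℝ) → Prop)
    (HE : ∀ A B : Set (Fin 2 → ℝ), E A B ↔
        ∃ (U : Set (Fin 2 → ℝ)) (Φ : (Fin 2 → ℝ) → (Fin 2 → ℝ)),
          U ⊆ A ∧ IsSemialgebraic ℚ U ∧ IsOpen U ∧ volume (A \ U) = 0 ∧
          IsSemialgebraicMapOn ℚ U Φ ∧ ContDiffOn ℝ 1 Φ U ∧ InjOn Φ U ∧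
          (∀ p ∈ U, |(fderiv ℝ Φ p).det| = 1) ∧ Φ '' U ⊆ B ∧ volume (B \ Φ '' U) = 0)
    (A B : {A : Set (Fin 2 → ℝ) // IsSemialgebraic ℚ A ∧ Bornology.IsBounded A}) :
    ∃ C : {A : Set (Fin 2 → ℝ) // IsSemialgebraic ℚ A ∧ Bornology.IsBounded A},
      Disjoint A.1 C.1 ∧ E B.1 C.1 := by
  obtain ⟨q, hq⟩ := assembly_exists_shift A.2.2 B.2.2
  exact ⟨⟨(fun x => x + fun i => (q i : ℝ)) '' B.1,
      mosaic_isSemialgebraic_translate B.2.1 _ q (fun i => rfl),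
      monoid_isBounded_translate B.2.2 _⟩, hq,
    mosaic_translate E HE B.2.1 _ q (fun i => rfl)⟩

/-- **The type monoid of bounded `ℚ`-regions modulo `E`.** Granted symmetry, transitivity and
gluing of the pinned relation `E`, there is an additive commutative monoid `M` with a map `mk`
from bounded `ℚ`-semialgebraic planar sets such that `mk A = mk B ↔ E A B`, `mk` is additive on
disjoint unions, `mk ∅ = 0`, and `mk` is onto.  (`M` is the quotient by `E`; the sum of two classes
is the class of the union of disjoint translates.) [folklore] -/
theorem assembly_exists_monoid (E : Set (Fin 2 → ℝ) → Set (Fin 2 → ℝ) → Prop)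
    (HE : ∀ A B : Set (Fin 2 → ℝ), E A B ↔
        ∃ (U : Set (Fin 2 → ℝ)) (Φ : (Fin 2 → ℝ) → (Fin 2 → ℝ)),
          U ⊆ A ∧ IsSemialgebraic ℚ U ∧ IsOpen U ∧ volume (A \ U) = 0 ∧
          IsSemialgebraicMapOn ℚ U Φ ∧ ContDiffOn ℝ 1 Φ U ∧ InjOn Φ U ∧
          (∀ p ∈ U, |(fderiv ℝ Φ p).det| = 1) ∧ Φ '' U ⊆ B ∧ volume (B \ Φ '' U) = 0)
    (hsymm : ∀ A B : Set (Fin 2 → ℝ), E A B → E B A)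
    (htrans : ∀ A B C : Set (Fin 2 → ℝ), E A B → E B C → E A C)
    (hglue : ∀ A₁ A₂ B₁ B₂ : Set (Fin 2 → ℝ), volume (A₁ ∩ A₂) = 0 → Disjoint B₁ B₂ →
      E A₁ B₁ → E A₂ B₂ → E (A₁ ∪ A₂) (B₁ ∪ B₂)) :
    ∃ (M : Type) (_ : AddCommMonoid M)
      (mk : {A : Set (Fin 2 → ℝ) // IsSemialgebraic ℚ A ∧ Bornology.IsBounded A} → M),
      (∀ A B : {A : Set (Fin 2 → ℝ) // IsSemialgebraic ℚ A ∧ Bornology.IsBounded A},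
        mk A = mk B ↔ E A.1 B.1) ∧
      (∀ A B : {A : Set (Fin 2 → ℝ) // IsSemialgebraic ℚ A ∧ Bornology.IsBounded A},
        Disjoint A.1 B.1 → mk A + mk B = mk ⟨A.1 ∪ B.1, A.2.1.union B.2.1, A.2.2.union B.2.2⟩) ∧
      mk ⟨∅, isSemialgebraic_empty, Bornology.isBounded_empty⟩ = 0 ∧
      Function.Surjective mk := by
  classical
  -- placement of a disjoint `E`-copy
  choose place hdisj hplace using monoid_exists_place E HE
  have hrefl :
      ∀ A : {A : Set (Fin 2 → ℝ) // IsSemialgebraic ℚ A ∧ Bornology.IsBounded A}, E A.1 A.1 :=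
    fun A => assembly_refl E HE A.2.1
  have hglue' : ∀ A₁ A₂ B₁ B₂ : Set (Fin 2 → ℝ), Disjoint A₁ A₂ → Disjoint B₁ B₂ →
      E A₁ B₁ → E A₂ B₂ → E (A₁ ∪ A₂) (B₁ ∪ B₂) :=
    fun A₁ A₂ B₁ B₂ h => hglue A₁ A₂ B₁ B₂ (by rw [h.inter_eq, measure_empty])
  -- raw addition on representatives
  set add' : {A : Set (Fin 2 → ℝ) // IsSemialgebraic ℚ A ∧ Bornology.IsBounded A} →
      {A : Set (Fin 2 → ℝ) // IsSemialgebraic ℚ A ∧ Bornology.IsBounded A} →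
      {A : Set (Fin 2 → ℝ) // IsSemialgebraic ℚ A ∧ Bornology.IsBounded A} := fun A B =>
    ⟨A.1 ∪ (place A B).1, A.2.1.union (place A B).2.1, A.2.2.union (place A B).2.2⟩ with hadd'
  have hadd'_val : ∀ A B : {A : Set (Fin 2 → ℝ) // IsSemialgebraic ℚ A ∧ Bornology.IsBounded A},
      (add' A B).1 = A.1 ∪ (place A B).1 := fun _ _ => rfl
  -- the sum is `E`-equivalent to `A ∪ C` for ANY disjoint `E`-copy `C` of `B`
  have hadd'_spec : ∀ (A B : {A : Set (Fin 2 → ℝ) // IsSemialgebraic ℚ A ∧ Bornology.IsBounded A})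
      (C : Set (Fin 2 → ℝ)), Disjoint A.1 C → E B.1 C → E (add' A B).1 (A.1 ∪ C) := by
    intro A B C hAC hBC
    rw [hadd'_val]
    exact hglue' _ _ _ _ (hdisj A B) hAC (hrefl A) (htrans _ _ _ (hsymm _ _ (hplace A B)) hBC)
  have hadd'_congr :
      ∀ A A' B B' : {A : Set (Fin 2 → ℝ) // IsSemialgebraic ℚ A ∧ Bornology.IsBounded A},
      E A.1 A'.1 → E B.1 B'.1 → E (add' A B).1 (add' A' B').1 := by
    intro A A' B B' hA hB
    rw [hadd'_val, hadd'_val]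
    exact hglue' _ _ _ _ (hdisj A B) (hdisj A' B') hA
      (htrans _ _ _ (hsymm _ _ (hplace A B)) (htrans _ _ _ hB (hplace A' B')))
  have hadd'_comm : ∀ A B : {A : Set (Fin 2 → ℝ) // IsSemialgebraic ℚ A ∧ Bornology.IsBounded A},
      E (add' A B).1 (add' B A).1 := by
    intro A B
    have h := hglue' A.1 (place A B).1 (place B A).1 B.1 (hdisj A B) (hdisj B A).symm
      (hplace B A) (hsymm _ _ (hplace A B))
    rw [hadd'_val, hadd'_val, union_comm B.1]
    exact h
  have hadd'_assoc : ∀ A B C : {A : Set (Fin 2 → ℝ) // IsSemialgebraic ℚ A ∧ Bornology.IsBounded A},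
      E (add' (add' A B) C).1 (add' A (add' B C)).1 := by
    intro A B C
    have hQ : E (place (add' A B) C).1 (place B C).1 :=
      htrans _ _ _ (hsymm _ _ (hplace (add' A B) C)) (hplace B C)
    have hdQ : Disjoint (add' A B).1 (place (add' A B) C).1 := hdisj (add' A B) C
    rw [hadd'_val] at hdQ
    have h1 : E ((place A B).1 ∪ (place (add' A B) C).1) (B.1 ∪ (place B C).1) :=
      hglue' _ _ _ _ (hdQ.mono_left subset_union_right) (hdisj B C) (hsymm _ _ (hplace A B)) hQ
    have h2 : E ((place A B).1 ∪ (place (add' A B) C).1) (place A (add' B C)).1 :=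
      htrans _ _ _ h1 (by rw [← hadd'_val]; exact hplace A (add' B C))
    have h3 : Disjoint A.1 ((place A B).1 ∪ (place (add' A B) C).1) :=
      Disjoint.union_right (hdisj A B) (hdQ.mono_left subset_union_left)
    have h4 := hglue' _ _ _ _ h3 (hdisj A (add' B C)) (hrefl A) h2
    rw [hadd'_val, hadd'_val, hadd'_val (A := A), union_assoc]
    exact h4
  set zero' : {A : Set (Fin 2 → ℝ) // IsSemialgebraic ℚ A ∧ Bornology.IsBounded A} :=
    ⟨∅, isSemialgebraic_empty, Bornology.isBounded_empty⟩ with hzero'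
  have hzero_add : ∀ A : {A : Set (Fin 2 → ℝ) // IsSemialgebraic ℚ A ∧ Bornology.IsBounded A},
      E (add' zero' A).1 A.1 := by
    intro A
    rw [hadd'_val]
    have h := hsymm _ _ (hplace zero' A)
    have h0 :
        (zero' : {A : Set (Fin 2 → ℝ) // IsSemialgebraic ℚ A ∧ Bornology.IsBounded A}).1 = ∅ := rfl
    rw [h0, empty_union]
    exact h
  -- the quotient
  letI R : Setoid {A : Set (Fin 2 → ℝ) // IsSemialgebraic ℚ A ∧ Bornology.IsBounded A} :=
    ⟨fun A B => E A.1 B.1, ⟨hrefl, fun h => hsymm _ _ h, fun h₁ h₂ => htrans _ _ _ h₁ h₂⟩⟩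
  have hequiv : ∀ A B : {A : Set (Fin 2 → ℝ) // IsSemialgebraic ℚ A ∧ Bornology.IsBounded A},
      A ≈ B ↔ E A.1 B.1 := fun _ _ => Iff.rfl
  letI instAdd : Add (Quotient R) :=
    ⟨Quotient.map₂ add' fun A A' hA B B' hB =>
      (hequiv _ _).2 (hadd'_congr A A' B B' ((hequiv _ _).1 hA) ((hequiv _ _).1 hB))⟩
  letI instZero : Zero (Quotient R) := ⟨Quotient.mk R zero'⟩
  have add_def : ∀ A B : {A : Set (Fin 2 → ℝ) // IsSemialgebraic ℚ A ∧ Bornology.IsBounded A},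
      (Quotient.mk R A + Quotient.mk R B : Quotient R) = Quotient.mk R (add' A B) :=
    fun _ _ => rfl
  have zero_def : (0 : Quotient R) = Quotient.mk R zero' := rfl
  have hsound : ∀ A B : {A : Set (Fin 2 → ℝ) // IsSemialgebraic ℚ A ∧ Bornology.IsBounded A},
      E A.1 B.1 → Quotient.mk R A = Quotient.mk R B :=
    fun A B h => Quotient.sound ((hequiv A B).2 h)
  letI inst : AddCommMonoid (Quotient R) :=
    { add := (· + ·)
      zero := 0
      nsmul := nsmulRec
      add_assoc := fun a b c => Quotient.inductionOn₃ a b c fun A B C => by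
        rw [add_def, add_def, add_def, add_def]
        exact hsound _ _ (hadd'_assoc A B C)
      zero_add := fun a => Quotient.inductionOn a fun A => by
        rw [zero_def, add_def]
        exact hsound _ _ (hzero_add A)
      add_comm := fun a b => Quotient.inductionOn₂ a b fun A B => by
        rw [add_def, add_def]
        exact hsound _ _ (hadd'_comm A B)
      add_zero := fun a => Quotient.inductionOn a fun A => by
        rw [zero_def, add_def]
        exact hsound _ _ (htrans _ _ _ (hadd'_comm A zero') (hzero_add A))
      nsmul_zero := fun _ => rfl
      nsmul_succ := fun _ _ => rfl }
  refine ⟨Quotient R, inst, Quotient.mk R, fun A B => ⟨fun h => Quotient.exact h, hsound A B⟩,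
    fun A B hAB => ?_, rfl, fun q => Quotient.exists_rep q⟩
  show (Quotient.mk R A + Quotient.mk R B : Quotient R) = _
  rw [add_def]
  exact hsound _ _ (hadd'_spec A B B.1 hAB (hrefl B))

/-- **The type monoid of bounded `ℚ`-regions modulo `E`** (stub `stub_monoid` of the line, the
closed form of `assembly_exists_monoid`, registered as a sub-goal of the assembly): symmetry,
transitivity and gluing of the pinned `E` give a commutative monoid presentation `(M, mk)` of
bounded `ℚ`-semialgebraic planar sets modulo `E`. [folklore] -/
theorem stub_monoid :
    ∀ (E : Set (Fin 2 → ℝ) → Set (Fin 2 → ℝ) → Prop),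
      (∀ A B : Set (Fin 2 → ℝ), E A B ↔
        ∃ (U : Set (Fin 2 → ℝ)) (Φ : (Fin 2 → ℝ) → (Fin 2 → ℝ)),
          U ⊆ A ∧ IsSemialgebraic ℚ U ∧ IsOpen U ∧ volume (A \ U) = 0 ∧
          IsSemialgebraicMapOn ℚ U Φ ∧ ContDiffOn ℝ 1 Φ U ∧ InjOn Φ U ∧
          (∀ p ∈ U, |(fderiv ℝ Φ p).det| = 1) ∧ Φ '' U ⊆ B ∧ volume (B \ Φ '' U) = 0) →
    (∀ A B : Set (Fin 2 → ℝ), E A B → E B A) →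
    (∀ A B C : Set (Fin 2 → ℝ), E A B → E B C → E A C) →
    (∀ A₁ A₂ B₁ B₂ : Set (Fin 2 → ℝ), volume (A₁ ∩ A₂) = 0 → Disjoint B₁ B₂ →
      E A₁ B₁ → E A₂ B₂ → E (A₁ ∪ A₂) (B₁ ∪ B₂)) →
    ∃ (M : Type) (_ : AddCommMonoid M)
      (mk : {A : Set (Fin 2 → ℝ) // IsSemialgebraic ℚ A ∧ Bornology.IsBounded A} → M),
      (∀ A B : {A : Set (Fin 2 → ℝ) // IsSemialgebraic ℚ A ∧ Bornology.IsBounded A},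
        mk A = mk B ↔ E A.1 B.1) ∧
      (∀ A B : {A : Set (Fin 2 → ℝ) // IsSemialgebraic ℚ A ∧ Bornology.IsBounded A},
        Disjoint A.1 B.1 → mk A + mk B = mk ⟨A.1 ∪ B.1, A.2.1.union B.2.1, A.2.2.union B.2.2⟩) ∧
      mk ⟨∅, isSemialgebraic_empty, Bornology.isBounded_empty⟩ = 0 ∧
      Function.Surjective mk := by
  intro E HE hsymm htrans hglue
  exact assembly_exists_monoid E HE hsymm htrans hglue

end Summit.KontsevichZagierPeriods.SymplecticScissors.PlanarSAZylev
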